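import Literature.AlgebraicGeometry.Resolution.AlterationsLemma411
import HarnessLib

/-!
# De Jong's alteration theorem: the printed proof of Lemma 4.11, cut at the choice of `π` and `p`

Topic: `Literature/AlgebraicGeometry/Resolution`. Sixth layer under `AlterationsInduction.lean`,
decomposing the named fact `DeJong1996Lemma411` of `AlterationsLemma411.lean` (de Jong 1996,
Lemma 4.11: a projective pair `(X, Z)` of dimension `d + 1` over an algebraically closed field,
`Z` the support of a divisor, is fibred in curves over `ℙ^d` after blowing up finitely many
regular closed points off `Z`; if `X` is normal one fibre may be taken smooth) along its printed
proof (p. 68), which runs: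

> "There exists a finite morphism `π : X → ℙ^d` which is étale over an open subset of `ℙ^d` and
> such that `π|_Z : Z → π(Z)` is birational. To construct such a `π`, we choose an embedding
> `X ↪ ℙ^N` and we let `π` be the composition of projection morphisms as in 2.11, adapted to `Z`
> and `X`. Let `B ⊂ ℙ^d` be the branch locus of `π` […]. Note that `π(Z)` is a reduced closed
> subscheme of `ℙ^d`, equidimensional of dimension `d - 1`. Therefore, for a general point
> `p ∈ ℙ^d`, `p ∉ B ∪ π(Z)`, the morphism `pr_p : π(Z) → ℙ^{d-1}` is étale over a nonempty open
> subscheme of `ℙ^{d-1}`. See 2.11. Choose `p` and put `X' = {(x, ℓ) ∈ X × ℙ^{d-1} | π(x) ∈ ℓ}`.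
> It is easy to see that `X'` equals the blowing up of `X` in the finite set `π⁻¹(p)`, which is
> contained in the regular locus of `X` (since `p ∉ B`) and disjoint from `Z` (since
> `p ∉ π(Z)`). The fibres of the morphism `f = pr₂ : X' → ℙ^{d-1}` are the schemes `π⁻¹(ℓ)`
> […]. Since `π⁻¹(ℓ) → ℓ` is finite, we see that `π⁻¹(ℓ)` has dimension at most 1. On the other
> hand, `ℓ` is given locally by `d - 1` equations, hence `π⁻¹(ℓ)` has at every point dimension
> at least 1, as `X` has pure dimension `d`. Any component of `π⁻¹(ℓ)` is finite over `ℓ`, hence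
> contains one of the points of `π⁻¹({p})`. Thus it suffices to show that `f` is smooth along
> the exceptional fibres `E_i` of `X' → X`. Locally in the étale topology, `f` along `E_i` looks
> like `pr_p : P̃^d → ℙ^{d-1}` along the exceptional fibre of the blowing up `P̃^d → ℙ^d` of `ℙ^d`
> in `p`. This proves (ii) a) and b). Assertion (ii) c) is clear as `Z' ≅ Z → π(Z) → ℙ^{d-1}` is
> generically étale by construction. To prove the last assertion, we go back to the method
> whereby we constructed `π`. […] By the usual Bertini arguments we see that choosing `L` and
> `p` general gives that there is at least one `H` such that the curve `X ∩ H` is smooth over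
> `k`."

Here (as in `AlterationsLemma411.lean`) the dimension `d ≥ 1` of the paper is written `d + 1`,
so the paper's `ℙ^d`, `ℙ^{d-1}` are `ℙ^{d+1}_k`, `ℙ^d_k`
(`Literature.AlgebraicGeometry.Motives.projectiveSpace`). The incidence variety
`{(y, ℓ) | y ∈ ℓ} ⊂ ℙ^{d+1} × ℙ^d` of points and lines through `p` is the blowing up
`b : P̃ → ℙ^{d+1}` of `ℙ^{d+1}` in `p`, and its second projection `q : P̃ → ℙ^d` is the linear
projection `pr_p` from `p` made a morphism (a `ℙ¹`-bundle whose fibre over `ℓ` is the line `ℓ`,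
the exceptional divisor `E = b⁻¹(p) ≅ ℙ^d` being a section); with these,
`X' = X ×_{ℙ^{d+1}} P̃`, `φ = pr₁ : X' → X` and `f = pr₂ ≫ q : X' → ℙ^d`. This file CUTS the
proof at the interface "`π` and `p` chosen, `(b, q)` given":

* `DeJong1996.PointBlowupProjection d k p b q` — hypothesis structure for the pair
  `(b : P̃ → ℙ^{d+1}, q = pr_p : P̃ → ℙ^d)`: `p` is a closed point, `b` is a blowing up of
  `ℙ^{d+1}_k` in (the reduced closed subscheme) `p` (`IsBlowup`, `Blowups.lean`), `q` is a
  `k`-morphism, smooth, with irreducible fibres of dimension `≤ 1`, each met by `E = b⁻¹(p)` —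
  exactly the properties of the `ℙ¹`-bundle `P̃ → ℙ^d` the printed proof consumes.
* `DeJong1996.Lemma411Projection fX Z d π p` — "`π` and `p` as chosen": `π : X → ℙ^{d+1}_k` a
  finite surjective `k`-morphism, étale over an open neighbourhood `V` of `p` ("`p ∉ B`"), and
  `p ∉ π(Z)`.
* `DeJong1996Lemma411GenericProjection` — NAMED FACT, the GENERIC part of the proof (first paragraph
  with 2.11; the choice of `p` with 2.11 (β); "(ii) c) is clear … by construction"; and the
  Bertini paragraph for d)): under the hypotheses of 4.11 there are `π`, `p` and `(b, q)` as
  above such that, for `X' = X ×_{ℙ^{d+1}} P̃`, `φ = pr₁`, `f = pr₂ ≫ q`, the morphism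
  `f|_{φ⁻¹Z}` is finite and generically étale, and — if `X` is normal — some fibre of `f` is
  smooth.
* `DeJong1996Lemma411Blowup` — NAMED FACT: "`X'` equals the blowing up of `X` in the finite set
  `π⁻¹(p)`, which is contained in the regular locus of `X` (since `p ∉ B`) and disjoint from `Z`
  (since `p ∉ π(Z))`" — Lemma 4.11 (i) for `φ = pr₁`.
* `DeJong1996Lemma411FibreDimension` — NAMED FACT: all fibres of `f` are non-empty and
  equidimensional of dimension `1` — Lemma 4.11 (ii) a).
* `DeJong1996Lemma411SmoothLocusDense` — NAMED FACT: given (ii) a), the smooth locus of `f` is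
  dense in all fibres of `f` ("Any component of `π⁻¹(ℓ)` […] contains one of the points of
  `π⁻¹({p})` […] `f` is smooth along the exceptional fibres") — Lemma 4.11 (ii) b).
* PROVED: `f` is a `k`-morphism (`DeJong1996.Lemma411Projection.fibration_comp_hom`); the
  conclusion (i), (ii) a)–c) of 4.11 for `(φ, f)` from the three construction facts and (ii) c)
  (`DeJong1996.isLemma411Fibration_of_blowup_of_fibreDimension_of_smoothLocusDense`); and the
  assembly **`DeJong1996Lemma411.of_genericProjection_of_construction`**: the four facts imply
  `DeJong1996Lemma411`; rewired down to `DeJong1996FibrationReduction` and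
  `DeJong1996StrongAlgClosed`.

Deliberately NOT here (the inputs of the four facts, see their docstrings): the linear projection
`pr_p : ℙ^{d+1} ∖ {p} → ℙ^d` and the incidence variety as schemes, de Jong's 2.11 (α), (β),
generic finite projections of projective varieties (Noether normalisation in projective form),
Bertini's theorem (Hartshorne II 8.18), for `DeJong1996Lemma411GenericProjection`; blowing ups and
flat base change (`BlowupsFlatBaseChange.lean`), locality of blowing ups (`BlowupsGlue.lean`) and
regularity under étale morphisms, for `DeJong1996Lemma411Blowup`; the fibre-dimension estimate
EGA IV 13.1.1 (Hartshorne II Ex. 3.22 (b)) and the invariance of dimension under finite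
surjective morphisms, for `DeJong1996Lemma411FibreDimension`; smoothness of `smooth ∘ étale` and
the openness of the smooth locus (Mathlib), for `DeJong1996Lemma411SmoothLocusDense`.

## Sources

* A. J. de Jong, *Smoothness, semi-stability and alterations*, Publ. Math. IHÉS 83 (1996) 51–93:
  2.6, 2.11 (pp. 55–56), Lemma 4.11 (p. 67) and its proof (p. 68). [DeJong1996]
* A. Grothendieck, *Éléments de géométrie algébrique* IV₃, Publ. Math. IHÉS 28 (1966),
  Thm. 13.1.1 (semi-continuity of fibre dimension); R. Hartshorne, *Algebraic Geometry* (1977),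
  II Ex. 3.22 (b), II Thm. 8.18. [Hartshorne1977]
-/

noncomputable section

open CategoryTheory CategoryTheory.Limits AlgebraicGeometry TopologicalSpace Topology

namespace Literature.AlgebraicGeometry.Resolution

universe u

open Literature.AlgebraicGeometry.Motives (projectiveSpace IsProjectiveOver)

namespace DeJong1996

/-! ## The interface: `(b, q) = (P̃ → ℙ^{d+1}, pr_p)` and `(π, p)` -/

/-- **The blowing up of `ℙ^{d+1}_k` in the closed point `p` with its projection to the `ℙ^d_k`
of lines through `p`** — hypothesis structure for the pair of morphisms
`(b : P̃ → ℙ^{d+1}, q : P̃ → ℙ^d)` of de Jong 1996, proof of Lemma 4.11: "Locally in the étale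
topology, `f` along `E_i` looks like `pr_p : P̃^d → ℙ^{d-1}` along the exceptional fibre of the
blowing up `P̃^d → ℙ^d` of `ℙ^d` in `p`" (there `d = dim X`; here the dimension is `d + 1`).
Classically `P̃ = {(y, ℓ) | y ∈ ℓ} ⊂ ℙ^{d+1} × ℙ^d` (points, and lines through `p`), `b = pr₁`
is the blowing up of `ℙ^{d+1}` in `p` with exceptional divisor `E = {p} × ℙ^d`, and `q = pr₂`
extends the linear projection `pr_p` from `p`; `q` is a `ℙ¹`-bundle (the fibre over `ℓ` is the
line `ℓ ≅ ℙ¹`) of which `E` is a section. Recorded are exactly the properties the printed proof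
consumes: `p` is a closed point; `b` is a blowing up of `ℙ^{d+1}_k` along the ideal sheaf of the
reduced closed subscheme `{p}` (universal property, `IsBlowup`, Görtz–Wedhorn Def. 13.90); `q`
is a morphism over `k`; `q` is smooth ("`f` is smooth along the exceptional fibres"); every
(scheme-theoretic) fibre `q⁻¹(ℓ)` is irreducible of dimension `≤ 1` ("`π⁻¹(ℓ) → ℓ` is finite,
[so] `π⁻¹(ℓ)` has dimension at most 1") and meets `E = b⁻¹(p)` ("Any component of `π⁻¹(ℓ)` is
finite over `ℓ`, hence contains one of the points of `π⁻¹({p})`").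
[cite: DeJong1996, Lemma 4.11 (proof), p. 68] -/
structure PointBlowupProjection (d : ℕ) (k : Type u) [Field k]
    (p : ↥(projectiveSpace (d + 1) k).left) {P : Scheme.{u}}
    (b : P ⟶ (projectiveSpace (d + 1) k).left) (q : P ⟶ (projectiveSpace d k).left) : Prop where
  /-- `p` is a closed point of `ℙ^{d+1}_k` -/
  isClosed_singleton : IsClosed ({p} : Set ↥(projectiveSpace (d + 1) k).left)
  /-- `b : P̃ → ℙ^{d+1}` is the blowing up of `ℙ^{d+1}_k` in the reduced closed point `p` -/
  isBlowup : IsBlowup b (Scheme.IdealSheafData.vanishingIdeal ⟨{p}, isClosed_singleton⟩)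
  /-- `q` is a `k`-morphism (`P̃` being a `k`-scheme through `b`) -/
  comp_hom : q ≫ (projectiveSpace d k).hom = b ≫ (projectiveSpace (d + 1) k).hom
  /-- `q = pr_p : P̃ → ℙ^d` is smooth (a `ℙ¹`-bundle) -/
  smooth : Smooth q
  /-- every fibre `q⁻¹(ℓ)` (the line `ℓ`) is irreducible, in particular non-empty -/
  irreducibleSpace_fiber : ∀ y : ↥(projectiveSpace d k).left, IrreducibleSpace ↥(q.fiber y)
  /-- every fibre `q⁻¹(ℓ)` (the line `ℓ`) has dimension `≤ 1` -/
  topologicalKrullDim_fiber_le_one : ∀ y : ↥(projectiveSpace d k).left,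
    topologicalKrullDim ↥(q.fiber y) ≤ 1
  /-- the exceptional divisor `E = b⁻¹(p)` meets every fibre of `q` (every line `ℓ` passes
  through `p`; `E ≅ ℙ^d` is a section of `q`) -/
  exists_apply_eq : ∀ y : ↥(projectiveSpace d k).left, ∃ e : P, b e = p ∧ q e = y

/-- **`π` and `p` as chosen in the proof of de Jong 1996, Lemma 4.11** for the pair
`(X → Spec k, Z)` of dimension `d + 1`: "There exists a finite morphism `π : X → ℙ^d` which is
étale over an open subset of `ℙ^d` […]. Let `B ⊂ ℙ^d` be the branch locus of `π`, more
precisely, the complement of `B` is the locus over which `π` is étale. […] for a general point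
`p ∈ ℙ^d`, `p ∉ B ∪ π(Z)` […]. Choose `p`" — rendered: `π : X → ℙ^{d+1}_k` is a `k`-morphism,
finite and surjective (the paper's `π` is finite from the `d`-dimensional `X` to `ℙ^d`, hence
onto), `π` is étale over an open neighbourhood `V` of `p` (`p ∉ B`), and `p ∉ π(Z)`. The
genericity of `π` and `p` beyond this (birationality of `π|_Z`, 2.11 (β) for `π(Z)`, Bertini) is
carried by the conclusions of `DeJong1996Lemma411GenericProjection`.
[cite: DeJong1996, Lemma 4.11 (proof), p. 68] -/
structure Lemma411Projection {k : Type u} [Field k] {X : Scheme.{u}} (fX : X ⟶ Spec (.of k))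
    (Z : Set X) (d : ℕ) (π : X ⟶ (projectiveSpace (d + 1) k).left)
    (p : ↥(projectiveSpace (d + 1) k).left) : Prop where
  /-- `π` is a morphism over `k` -/
  comp_hom : π ≫ (projectiveSpace (d + 1) k).hom = fX
  /-- `π` is finite -/
  isFinite : IsFinite π
  /-- `π` is surjective -/
  surjective : Surjective π
  /-- `p ∉ B`: `π` is étale over an open neighbourhood of `p` -/
  exists_etale_morphismRestrict :
    ∃ V : (projectiveSpace (d + 1) k).left.Opens, p ∈ V ∧ Etale (π ∣_ V)
  /-- `p ∉ π(Z)` -/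
  notMem_image : p ∉ π '' Z

/-- `f = pr₂ ≫ q : X' = X ×_{ℙ^{d+1}} P̃ → ℙ^d` is a morphism of `k`-schemes, `X'` being a
`k`-scheme through `φ = pr₁ : X' → X`: `f ≫ (ℙ^d → Spec k) = φ ≫ (X → Spec k)`. [folklore] -/
theorem Lemma411Projection.fibration_comp_hom {k : Type u} [Field k] {X : Scheme.{u}}
    {fX : X ⟶ Spec (.of k)} {Z : Set X} {d : ℕ} {π : X ⟶ (projectiveSpace (d + 1) k).left}
    {p : ↥(projectiveSpace (d + 1) k).left} {P : Scheme.{u}}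
    {b : P ⟶ (projectiveSpace (d + 1) k).left} {q : P ⟶ (projectiveSpace d k).left}
    (hπ : Lemma411Projection fX Z d π p) (hM : PointBlowupProjection d k p b q) :
    (pullback.snd π b ≫ q) ≫ (projectiveSpace d k).hom = pullback.fst π b ≫ fX := by
  rw [Category.assoc, hM.comp_hom, ← pullback.condition_assoc, hπ.comp_hom]

end DeJong1996

/-! ## The generic part and the three construction steps as named facts -/

/-- NAMED FACT — **de Jong 1996, proof of Lemma 4.11: the choice of `π` and `p`** (with 2.11,
2.11 (β) and Bertini). Suppose `(X, Z)` over the algebraically closed field `k` satisfies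
(ii)–(iv) of 4.6–4.8 (`X` a projective variety, `Z` the support of an effective Cartier
divisor) and `dim X = d + 1`. "There exists a finite morphism `π : X → ℙ^d` which is étale over
an open subset of `ℙ^d` and such that `π|_Z : Z → π(Z)` is birational. […] for a general point
`p ∈ ℙ^d`, `p ∉ B ∪ π(Z)`, the morphism `pr_p : π(Z) → ℙ^{d-1}` is étale over a nonempty open
subscheme of `ℙ^{d-1}`. See 2.11. Choose `p` […]. Assertion (ii) c) is clear as
`Z' ≅ Z → π(Z) → ℙ^{d-1}` is generically étale by construction. To prove the last assertion
[d): if `X` is normal, at least one fibre of `f` is smooth] […] By the usual Bertini arguments we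
see that choosing `L` and `p` general gives that there is at least one `H` such that the curve
`X ∩ H` is smooth over `k`." Rendered on the interface of this file: there are `π` and `p` as in
`DeJong1996.Lemma411Projection` and a pair `(b : P̃ → ℙ^{d+1}, q : P̃ → ℙ^d)` as in
`DeJong1996.PointBlowupProjection` (the blowing up of `ℙ^{d+1}` in `p` with `pr_p`) such that,
writing `X' = X ×_{ℙ^{d+1}} P̃` (`pullback π b`), `φ = pr₁`, `f = pr₂ ≫ q` (whose fibres are the
`π⁻¹(ℓ) = X ∩ H`): `f|_{φ⁻¹Z}` is finite and generically étale
(`DeJong1996.IsFiniteGenericallyEtaleOn`, the rendering of (ii) c) of `AlterationsLemma411.lean`),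
and, if `X` is normal ((v): all local rings integrally closed), the fibre of `f` at some point
`y ∈ ℙ^d` is smooth over `κ(y)`. Inputs of the printed proof: linear projections from points and
their composites (2.11 (α), (β)), the equidimensionality of `π(Z)`, the incidence variety
`P̃ ⊂ ℙ^{d+1} × ℙ^d` with its two projections, and Bertini's theorem for the linear sections
`X ∩ H`, `H ⊃ L'`. Users take `(h : DeJong1996Lemma411GenericProjection)`.
[cite: DeJong1996, Lemma 4.11 (proof), p. 68] -/
def DeJong1996Lemma411GenericProjection : Prop :=
  ∀ (k : Type u) [Field k] [IsAlgClosed k] (X : Scheme.{u}) (fX : X ⟶ Spec (.of k)) (Z : Set X)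
    (d : ℕ), IsIntegral X → IsProjectiveOver (Over.mk fX) →
      (∃ D : X.IdealSheafData, IsEffectiveCartier D ∧ (D.support : Set X) = Z) →
        topologicalKrullDim X = (d + 1 : ℕ) →
          ∃ (π : X ⟶ (projectiveSpace (d + 1) k).left) (p : ↥(projectiveSpace (d + 1) k).left)
            (P : Scheme.{u}) (b : P ⟶ (projectiveSpace (d + 1) k).left)
            (q : P ⟶ (projectiveSpace d k).left),
            DeJong1996.Lemma411Projection fX Z d π p ∧ DeJong1996.PointBlowupProjection d k p b q ∧
              DeJong1996.IsFiniteGenericallyEtaleOn (pullback.snd π b ≫ q)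
                  ((pullback.fst π b) ⁻¹' Z) ∧
                ((∀ x : X, IsIntegrallyClosed (X.presheaf.stalk x)) →
                  ∃ y : ↥(projectiveSpace d k).left,
                    Smooth ((pullback.snd π b ≫ q).fiberToSpecResidueField y))

/-- NAMED FACT — **de Jong 1996, proof of Lemma 4.11: `X'` is the blowing up of `X` in
`π⁻¹(p)`** (Lemma 4.11 (i)). "Choose `p` and put `X' = {(x, ℓ) ∈ X × ℙ^{d-1} | π(x) ∈ ℓ}`. It is
easy to see that `X'` equals the blowing up of `X` in the finite set `π⁻¹(p)`, which is contained
in the regular locus of `X` (since `p ∉ B`) and disjoint from `Z` (since `p ∉ π(Z)`)." Rendered: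
for `π`, `p` as in `DeJong1996.Lemma411Projection` and `(b, q)` as in
`DeJong1996.PointBlowupProjection`, over an algebraically closed field, the set
`S = π⁻¹({p}) ⊂ X` is closed and finite, consists of closed points, lies in the regular locus
`Reg(X)` (`Scheme.regularLocus`), is disjoint from `Z`, and `φ = pr₁ : X ×_{ℙ^{d+1}} P̃ → X` is a
blowing up of `X` along the ideal sheaf `𝓘_S` of the reduced closed subscheme `S`
(`IsBlowup`). (Behind it: `π` is finite, and étale over `V ∋ p`, so the scheme-theoretic fibre
`π⁻¹(p)` is the reduced `S` and `(π^* 𝓘_p)|_{π⁻¹V} = 𝓘_S|_{π⁻¹V}`; blowing up commutes with the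
flat base change `π⁻¹V → V`, `φ` is an isomorphism over `X ∖ S` where `𝓘_S` is the unit ideal,
and being a blowing up is local on the base; `ℙ^{d+1}_k` is regular and regularity ascends along
étale morphisms.) Users take `(h : DeJong1996Lemma411Blowup)`.
[cite: DeJong1996, Lemma 4.11 (proof), p. 68] -/
def DeJong1996Lemma411Blowup : Prop :=
  ∀ (k : Type u) [Field k] [IsAlgClosed k] (X : Scheme.{u}) (fX : X ⟶ Spec (.of k)) (Z : Set X)
    (d : ℕ) (π : X ⟶ (projectiveSpace (d + 1) k).left) (p : ↥(projectiveSpace (d + 1) k).left)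
    (P : Scheme.{u}) (b : P ⟶ (projectiveSpace (d + 1) k).left)
    (q : P ⟶ (projectiveSpace d k).left),
    DeJong1996.Lemma411Projection fX Z d π p → DeJong1996.PointBlowupProjection d k p b q →
      ∃ hS : IsClosed (π ⁻¹' {p}), (π ⁻¹' {p}).Finite ∧ (∀ s ∈ π ⁻¹' {p}, IsClosed ({s} : Set X)) ∧
        π ⁻¹' {p} ⊆ Scheme.regularLocus X ∧ Disjoint (π ⁻¹' {p}) Z ∧
          IsBlowup (pullback.fst π b) (Scheme.IdealSheafData.vanishingIdeal ⟨π ⁻¹' {p}, hS⟩)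

/-- NAMED FACT — **de Jong 1996, proof of Lemma 4.11: the fibres of `f` are curves**
(Lemma 4.11 (ii) a): "All fibres of `f` are equidimensional of dimension 1 and nonempty"). "The
fibres of the morphism `f = pr₂ : X' → ℙ^{d-1}` are the schemes `π⁻¹(ℓ)` (scheme theoretic
inverse image, i.e. `π⁻¹(ℓ) = ℓ ×_{ℙ^d} X`). Since `π⁻¹(ℓ) → ℓ` is finite, we see that `π⁻¹(ℓ)`
has dimension at most 1. On the other hand, `ℓ` is given locally by `d - 1` equations, hence
`π⁻¹(ℓ)` has at every point dimension at least 1, as `X` has pure dimension `d`." Rendered: for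
`X` a projective variety of dimension `d + 1` over the algebraically closed field `k`, `π`, `p`
as in `DeJong1996.Lemma411Projection` and `(b, q)` as in `DeJong1996.PointBlowupProjection`, the
morphism `f = pr₂ ≫ q : X ×_{ℙ^{d+1}} P̃ → ℙ^d` is surjective and every irreducible component of
every (scheme-theoretic) fibre `f⁻¹(y)`, `y ∈ ℙ^d`, has dimension `1` (as in
`DeJong1996.IsCurveFibration`). (Behind it: `f⁻¹(y) → q⁻¹(y)` is finite, a base change of `π`,
and `dim q⁻¹(y) ≤ 1`; `X'` is integral of dimension `d + 1`, being a blowing up of `X` in a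
non-dense closed set, and dominates `ℙ^d`, so every component of every fibre has dimension `≥ 1`
by EGA IV 13.1.1 / Hartshorne II Ex. 3.22 (b).) Users take
`(h : DeJong1996Lemma411FibreDimension)`. [cite: DeJong1996, Lemma 4.11 (proof), p. 68] -/
def DeJong1996Lemma411FibreDimension : Prop :=
  ∀ (k : Type u) [Field k] [IsAlgClosed k] (X : Scheme.{u}) (fX : X ⟶ Spec (.of k)) (Z : Set X)
    (d : ℕ) (π : X ⟶ (projectiveSpace (d + 1) k).left) (p : ↥(projectiveSpace (d + 1) k).left)
    (P : Scheme.{u}) (b : P ⟶ (projectiveSpace (d + 1) k).left)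
    (q : P ⟶ (projectiveSpace d k).left), IsIntegral X → IsProjectiveOver (Over.mk fX) →
      topologicalKrullDim X = (d + 1 : ℕ) →
        DeJong1996.Lemma411Projection fX Z d π p → DeJong1996.PointBlowupProjection d k p b q →
          Surjective (pullback.snd π b ≫ q) ∧
            ∀ (y : ↥(projectiveSpace d k).left),
              ∀ C ∈ irreducibleComponents ↥((pullback.snd π b ≫ q).fiber y),
                topologicalKrullDim C = 1

/-- NAMED FACT — **de Jong 1996, proof of Lemma 4.11: the smooth locus of `f` is dense in all
fibres** (Lemma 4.11 (ii) b)). "Any component of `π⁻¹(ℓ)` is finite over `ℓ`, hence contains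
one of the points of `π⁻¹({p})`. Thus it suffices to show that `f` is smooth along the
exceptional fibres `E_i` of `X' → X`. Locally in the étale topology, `f` along `E_i` looks like
`pr_p : P̃^d → ℙ^{d-1}` along the exceptional fibre of the blowing up `P̃^d → ℙ^d` of `ℙ^d` in
`p`. This proves (ii) a) and b)." Rendered: for `X` a projective variety over the algebraically
closed field `k`, `π`, `p` as in `DeJong1996.Lemma411Projection`, `(b, q)` as in
`DeJong1996.PointBlowupProjection`, and `f = pr₂ ≫ q : X' = X ×_{ℙ^{d+1}} P̃ → ℙ^d` all of whose
fibres are equidimensional of dimension `1` (the conclusion of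
`DeJong1996Lemma411FibreDimension`): `f` is locally of finite presentation and the smooth locus
`sm(f)` (2.5, Mathlib's `Scheme.Hom.smoothLocus`) is dense in every fibre `f⁻¹(y)`. (Behind it:
`pr₂ : X' → P̃` is étale over `b⁻¹(V) ⊃ E`, a base change of `π|_{π⁻¹V}`, and `q` is smooth, so
`f` is smooth at every point over `V`; a `1`-dimensional irreducible component of `f⁻¹(y)` maps
finitely onto the irreducible, at most `1`-dimensional `q⁻¹(y)`, hence meets `pr₂⁻¹(E)`; a
non-empty open subset of an irreducible component is dense in it.) Users take
`(h : DeJong1996Lemma411SmoothLocusDense)`. [cite: DeJong1996, Lemma 4.11 (proof), p. 68] -/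
def DeJong1996Lemma411SmoothLocusDense : Prop :=
  ∀ (k : Type u) [Field k] [IsAlgClosed k] (X : Scheme.{u}) (fX : X ⟶ Spec (.of k)) (Z : Set X)
    (d : ℕ) (π : X ⟶ (projectiveSpace (d + 1) k).left) (p : ↥(projectiveSpace (d + 1) k).left)
    (P : Scheme.{u}) (b : P ⟶ (projectiveSpace (d + 1) k).left)
    (q : P ⟶ (projectiveSpace d k).left), IsIntegral X → IsProjectiveOver (Over.mk fX) →
      DeJong1996.Lemma411Projection fX Z d π p → DeJong1996.PointBlowupProjection d k p b q →
        (∀ (y : ↥(projectiveSpace d k).left),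
          ∀ C ∈ irreducibleComponents ↥((pullback.snd π b ≫ q).fiber y),
            topologicalKrullDim C = 1) →
          ∃ h : LocallyOfFinitePresentation (pullback.snd π b ≫ q),
            ∀ y : ↥(projectiveSpace d k).left,
              Dense (((pullback.snd π b ≫ q).fiberι y) ⁻¹'
                ((@Scheme.Hom.smoothLocus _ _ (pullback.snd π b ≫ q) h :
                  (pullback π b).Opens) : Set ↥(pullback π b)))

/-! ## The assembly -/

namespace DeJong1996

/-- **The conclusion (i), (ii) a)–c) of Lemma 4.11 for `(φ, f) = (pr₁, pr₂ ≫ q)`** from the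
three construction facts and (ii) c): with `π`, `p`, `(b, q)` as in the two interface structures,
`X` a projective variety of dimension `d + 1` over an algebraically closed field, and
`f|_{φ⁻¹Z}` finite and generically étale, the pair `(φ, f)` satisfies
`DeJong1996.IsLemma411Fibration` — (i) by `DeJong1996Lemma411Blowup` (with `S = π⁻¹(p)`),
"`f` […] of varieties" over `k` by `Lemma411Projection.fibration_comp_hom`, (ii) a) by
`DeJong1996Lemma411FibreDimension`, (ii) b) by `DeJong1996Lemma411SmoothLocusDense`.
[cite: DeJong1996, Lemma 4.11 (proof), p. 68] -/
theorem isLemma411Fibration_of_blowup_of_fibreDimension_of_smoothLocusDense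
    (hB₁ : DeJong1996Lemma411Blowup.{u}) (hB₂ : DeJong1996Lemma411FibreDimension.{u})
    (hB₃ : DeJong1996Lemma411SmoothLocusDense.{u}) {k : Type u} [Field k] [IsAlgClosed k]
    {X : Scheme.{u}} {fX : X ⟶ Spec (.of k)} {Z : Set X} {d : ℕ}
    {π : X ⟶ (projectiveSpace (d + 1) k).left} {p : ↥(projectiveSpace (d + 1) k).left}
    {P : Scheme.{u}} {b : P ⟶ (projectiveSpace (d + 1) k).left}
    {q : P ⟶ (projectiveSpace d k).left} [IsIntegral X] (hX : IsProjectiveOver (Over.mk fX))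
    (hdim : topologicalKrullDim X = (d + 1 : ℕ)) (hπ : Lemma411Projection fX Z d π p)
    (hM : PointBlowupProjection d k p b q)
    (hc : IsFiniteGenericallyEtaleOn (pullback.snd π b ≫ q) ((pullback.fst π b) ⁻¹' Z)) :
    IsLemma411Fibration fX Z d (pullback.fst π b) (pullback.snd π b ≫ q) := by
  obtain ⟨hS, hSf, hSc, hSreg, hSZ, hblow⟩ := hB₁ k X fX Z d π p P b q hπ hM
  obtain ⟨hsurj, hdim1⟩ := hB₂ k X fX Z d π p P b q ‹_› hX hdim hπ hM
  obtain ⟨hlfp, hdense⟩ := hB₃ k X fX Z d π p P b q ‹_› hX hπ hM hdim1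
  exact
    { exists_isBlowup := ⟨π ⁻¹' {p}, hS, hSf, hSc, hSreg, hSZ, hblow⟩
      comp_hom := hπ.fibration_comp_hom hM
      locallyOfFinitePresentation := hlfp
      surjective := hsurj
      topologicalKrullDim_eq_one := hdim1
      dense_preimage_smoothLocus := hdense
      isFiniteGenericallyEtaleOn := hc }

end DeJong1996

/-- **de Jong 1996, Lemma 4.11 assembled along its printed proof**: the generic choice of `π`,
`p` (`DeJong1996Lemma411GenericProjection`: 2.11, (ii) c), Bertini) and the three construction steps
(`DeJong1996Lemma411Blowup`: (i); `DeJong1996Lemma411FibreDimension`: (ii) a);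
`DeJong1996Lemma411SmoothLocusDense`: (ii) b)) imply `DeJong1996Lemma411` — both sentences with
the same `X' = X ×_{ℙ^{d+1}} P̃`, `φ = pr₁`, `f = pr₂ ≫ q`, the smooth fibre of d) being provided
by `DeJong1996Lemma411GenericProjection` when `X` is normal.
[cite: DeJong1996, Lemma 4.11 and its proof, pp. 67–68] -/
theorem DeJong1996Lemma411.of_genericProjection_of_construction
    (hA : DeJong1996Lemma411GenericProjection.{u}) (hB₁ : DeJong1996Lemma411Blowup.{u})
    (hB₂ : DeJong1996Lemma411FibreDimension.{u}) (hB₃ : DeJong1996Lemma411SmoothLocusDense.{u}) :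
    DeJong1996Lemma411.{u} := by
  intro k _ _ X fX Z d hint hX hZ hdim
  obtain ⟨π, p, P, b, q, hπ, hM, hc, hd⟩ := hA k X fX Z d hint hX hZ hdim
  haveI := hint
  have hF :=
    DeJong1996.isLemma411Fibration_of_blowup_of_fibreDimension_of_smoothLocusDense hB₁ hB₂ hB₃
      hX hdim hπ hM hc
  exact ⟨⟨_, _, _, hF⟩, fun hn => ⟨_, _, _, hF, hd hn⟩⟩

/-- `DeJong1996FibrationReduction` (4.11 with 4.12) from the five facts of the decomposition of
4.11 and the two inputs of 4.12 (`DeJong1996SmoothOverOpen`: 2.8;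
`DeJong1996FibresGeometricallyConnected`: Stein factorisation and [18]) with the projectivity of
blowing ups (`BlowupProjectiveOverField`). [cite: DeJong1996, 4.11–4.12, pp. 67–69] -/
theorem DeJong1996FibrationReduction.of_genericProjection_of_construction
    (hB : BlowupProjectiveOverField.{u}) (hA : DeJong1996Lemma411GenericProjection.{u})
    (hB₁ : DeJong1996Lemma411Blowup.{u}) (hB₂ : DeJong1996Lemma411FibreDimension.{u})
    (hB₃ : DeJong1996Lemma411SmoothLocusDense.{u}) (h28 : DeJong1996SmoothOverOpen.{u})
    (hc : DeJong1996FibresGeometricallyConnected.{u}) : DeJong1996FibrationReduction.{u} :=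
  DeJong1996FibrationReduction.of_lemma411 hB
    (DeJong1996Lemma411.of_genericProjection_of_construction hA hB₁ hB₂ hB₃) h28 hc

/-- **Thm. 4.1 with its generically-étale clause over algebraically closed fields** from the
projectivity of blowing ups, the four facts of this file (Lemma 4.11), the two inputs of 4.12 and
4.13–4.28 (`DeJong1996NormalProjectiveStepVI`). [cite: DeJong1996, 4.3–4.12, pp. 66–69] -/
theorem DeJong1996StrongAlgClosed.of_blowupProjective_of_genericProjection_of_construction_of_stepVI
    (hB : BlowupProjectiveOverField.{u}) (hA : DeJong1996Lemma411GenericProjection.{u})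
    (hB₁ : DeJong1996Lemma411Blowup.{u}) (hB₂ : DeJong1996Lemma411FibreDimension.{u})
    (hB₃ : DeJong1996Lemma411SmoothLocusDense.{u}) (h28 : DeJong1996SmoothOverOpen.{u})
    (hc : DeJong1996FibresGeometricallyConnected.{u})
    (h₂ : DeJong1996NormalProjectiveStepVI.{u}) : DeJong1996StrongAlgClosed.{u} :=
  DeJong1996StrongAlgClosed.of_blowupProjective_of_lemma411_of_stepVI hB
    (DeJong1996Lemma411.of_genericProjection_of_construction hA hB₁ hB₂ hB₃) h28 hc h₂

end Literature.AlgebraicGeometry.Resolution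

end
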